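import Summits.BirchSwinnertonDyer.BirchSwinnertonDyer.Theorems.ClassRecordThreeEulerHalvesAtThreeCartanTorusCubeCut
import Summits.BirchSwinnertonDyer.BirchSwinnertonDyer.Theorems.ClassRecordThreeEulerHalvesAtThreeCartanTorusCubeCutCuspChar
import Summits.BirchSwinnertonDyer.BirchSwinnertonDyer.Theorems.ClassRecordThreeEulerHalvesAtThreeCartanTorusCubeCutPSCentre
import HarnessLib

/-!
# Crux 19109 `EulerHalvesAtThree` ∕ 23422 line `cartan` v8′, stub (F2a): the TORUS-CUBE CUT of S-K1′ — input (C1) PROVED: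
# in the cuspidal case `q ≡ 2 (mod 3)` the cube norm `N_{T_C³} x` is fixed by the whole non-split torus (`3·N_{T_C³} = N_{T_C}`)

Seat `bsd-stepL-tam3-p1` g21 (LINE OWNER of crux 23422; `--supports stmt-BirchSwinnertonDyer-23422 --as helper`). CONTENT, all PROVED:
* **(C1) `P_cuspCubeNormFixed` PROVED BY NAME** (`cuspCubeNormFixed : P_cuspCubeNormFixed`, the named input of bsd-idea-10 g11's cut file
  `…CartanTorusCubeCut` p683297; the character sums `Σ_{T_C} χ_W = |T_C|`, `Σ_{T_C³} χ_W = |T_C³|` come from `…CuspChar`, the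
  ℤ-lattice lemma «`D² = n·D`, `tr D = 0` ⇒ `D = 0`» and `tr N_S = Σ χ_W` from cartan-f2a g0's `…PSCentre`): with `N = N_{T_C}`,
  `N₃ = N_{T_C³}` one has
  `N² = |T_C|·N`, `N₃² = |T_C³|·N₃`, `N₃N = NN₃ = |T_C³|·N`, `tr N = |T_C| = 3|T_C³| = 3·tr N₃`, so `D = 3N₃ − N` satisfies
  `D² = |T_C|·D`, `tr D = 0`, whence `D = 0`: `3·N₃ = N`, and `N₃ x` is `T_C`-fixed because `N x` is and `ℤ^d` has no `3`-torsion.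
HONEST FRAMING: finite-group averaging on one integral lattice; nothing about any curve, `L`-value or period; S-K1′ is NOT proved here
(inputs (C2), (P1)–(P3) of the cut remain); no summit statement, no route item and no registered stub is proved; BSD is proved for no
curve. [folklore; background: cite: Bump1997, §4.1]
-/

namespace Summit.BirchSwinnertonDyer.BirchSwinnertonDyer.Theorems.CartanTorusCubeCut

open Summit.BirchSwinnertonDyer.BirchSwinnertonDyer.Theorems.CartanDegree

open scoped Classical

set_option linter.dupNamespace false
set_option autoImplicit false

noncomputable section

variable {q : ℕ} [Fact q.Prime]

/-! ### (C1): `3·N_{T_C³} = N_{T_C}`, so cube norms are torus-fixed -/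

section C1

variable (𝓛 : CartanTorusLattice q)

/-- `N_S · N_{S'} = |S|·N_{S'}` when every element of `S` fixes `N_{S'}` on the left. -/
theorem normOp_mul_normOp_of_fix {S S' : Finset (G q)} (h : ∀ u ∈ S, ∀ x, 𝓛.ρ u (normOp 𝓛 S' x) = normOp 𝓛 S' x) :
    normOp 𝓛 S * normOp 𝓛 S' = (S.card : ℤ) • normOp 𝓛 S' := by
  apply LinearMap.ext
  intro x
  rw [Module.End.mul_apply, normOp_apply 𝓛 S, Finset.sum_congr rfl (fun u hu => h u hu x), Finset.sum_const,
    LinearMap.smul_apply]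
  simp

/-- `N_{T_C}` and `N_{T_C³}` commute (the torus is commutative). -/
theorem normOp_torus_comm (hη : ¬ HasRatEigenvalue 𝓛.η) :
    normOp 𝓛 (nonsplitTorus 𝓛.η) * normOp 𝓛 (nonsplitCubes 𝓛.η) =
      normOp 𝓛 (nonsplitCubes 𝓛.η) * normOp 𝓛 (nonsplitTorus 𝓛.η) := by
  unfold normOp
  rw [Finset.sum_mul_sum, Finset.sum_mul_sum]
  conv_lhs => rw [Finset.sum_comm]
  refine Finset.sum_congr rfl (fun s hs => Finset.sum_congr rfl (fun t ht => ?_))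
  rw [← map_mul, ← map_mul, nonsplitTorus_comm hη ht (nonsplitCubes_subset _ hs)]

/-- **Input (C1) of the torus-cube cut, PROVED** (the body of `P_cuspCubeNormFixed` of `Lines/cartan_sk1.lean`, verbatim): for
`q ≡ 2 (mod 3)`, `q ≥ 5`, the cube norm `N_{T_C³} x` of every lattice vector is fixed by the whole non-split torus. -/
theorem cuspCubeNormFixed : P_cuspCubeNormFixed := by
  unfold P_cuspCubeNormFixed
  intro q _ hq5 hq3 𝓛 x
  have hη := 𝓛.η_irred
  set T := nonsplitTorus 𝓛.η with hT
  set T3 := nonsplitCubes 𝓛.η with hT3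
  set N := normOp 𝓛 T with hN
  set N₃ := normOp 𝓛 T3 with hN₃
  -- cardinalities: |T| = 3 |T³|
  have hcard3 := nonsplitCubes_card hη hq5
  have hcardT := nonsplitTorus_card hη
  have hc : (T.card : ℤ) = 3 * (T3.card : ℤ) := by
    rw [hT, hT3, hcardT]; exact_mod_cast hcard3.symm
  have hTpos : (T.card : ℤ) ≠ 0 := by
    rw [hT, hcardT]; have : 1 ≤ q := by omega
    exact_mod_cast (Nat.mul_pos (by omega) (by omega)).ne'
  -- fixing relations
  have fixT : ∀ u ∈ T, ∀ y, 𝓛.ρ u (N y) = N y :=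
    fun u hu y => rho_mul_normOp 𝓛 (fun a ha b hb => nonsplitTorus_mul_mem ha hb) hu y
  have fix3 : ∀ u ∈ T3, ∀ y, 𝓛.ρ u (N₃ y) = N₃ y :=
    fun u hu y => rho_mul_normOp 𝓛 (fun a ha b hb => nonsplitCubes_mul_mem hη ha hb) hu y
  have hNN : N * N = (T.card : ℤ) • N := normOp_mul_normOp_of_fix 𝓛 fixT
  have h33 : N₃ * N₃ = (T3.card : ℤ) • N₃ := normOp_mul_normOp_of_fix 𝓛 fix3
  have h3N : N₃ * N = (T3.card : ℤ) • N :=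
    normOp_mul_normOp_of_fix 𝓛 (fun u hu y => fixT u (nonsplitCubes_subset _ hu) y)
  have hN3 : N * N₃ = (T3.card : ℤ) • N := by
    rw [hN, hN₃, hT, hT3, normOp_torus_comm 𝓛 hη]; exact h3N
  -- traces
  have trN : LinearMap.trace ℤ _ N = (T.card : ℤ) := by
    rw [hN, PS.trace_normOp, hT, sum_char_nonsplitTorus hη hq5 hq3]
  have trN3 : LinearMap.trace ℤ _ N₃ = (T3.card : ℤ) := by
    rw [hN₃, PS.trace_normOp, hT3, sum_char_nonsplitCubes hη hq5 hq3]
  -- D = 3 N₃ − N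
  set D := (3 : ℤ) • N₃ - N with hD
  have hD2 : D * D = (T.card : ℤ) • D := by
    rw [hD, sub_mul, mul_sub, mul_sub, smul_mul_assoc, mul_smul_comm, smul_mul_assoc, mul_smul_comm, h33, h3N, hN3,
      hNN, hc]
    module
  have hDtr : LinearMap.trace ℤ _ D = 0 := by
    rw [hD, map_sub, map_zsmul, trN, trN3, hc]; ring
  have hD0 : D = 0 := PS.eq_zero_of_mul_self_eq_smul_of_trace_eq_zero D _ hTpos hD2 hDtr
  have h3eq : (3 : ℤ) • N₃ = N := sub_eq_zero.1 (by rw [← hD]; exact hD0)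
  -- conclusion
  intro g hg
  have hgT : g ∈ T := by rw [hT]; simpa [nonsplitTorus] using hg
  have h1 : (3 : ℤ) • (𝓛.ρ g (N₃ x)) = (3 : ℤ) • N₃ x := by
    rw [← LinearMap.map_smul_of_tower, ← LinearMap.smul_apply, h3eq, fixT g hgT x]
  exact smul_right_injective _ (by norm_num : (3 : ℤ) ≠ 0) h1

end C1

end

end Summit.BirchSwinnertonDyer.BirchSwinnertonDyer.Theorems.CartanTorusCubeCut
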